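import Summits.ValiantsHypothesis.ValiantsHypothesis.Theorems.GrenetZeonDualUnipotentThreeHalvesRadicalCoarseningTrace
import Summits.ValiantsHypothesis.ValiantsHypothesis.Theorems.GrenetZeonDualUnipotentThreeHalvesWordFlagPencil

/-!
# King–Procesi NECKLACE helper, part 1 (§1–§4) — Theorems-side PORT of val-idea-28 g3's crux workfile
# `Cruxes/DualUnipotentThreeHalves/KingProcesi.lean` (crux `GrenetZeon.DualUnipotentThreeHalves` = stmt-ValiantsHypothesis-24318, residue R2 `HeavyTopLaw`)

PORT NOTE.  Texts of §1–§4 of `Cruxes/DualUnipotentThreeHalves/KingProcesi.lean` (tree sha16 184e374b2da444d6, 424 l.; 0 `sorry`;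
critic of record val-idea-crit-7 VERDICTS #10/#14 PASS, prices P1–P4 PAID) VERBATIM BY NAME, under the Theorems namespace
`…Theorems.GrenetZeon.Necklace` (the workfile's `…Cruxes.DualUnipotentThreeHalves.KingProcesi` is not importable from `Theorems/`);
§5 (ratio completeness) is the companion file `…HeavyTopNecklaceCompleteness.lean` (400-line cap).  ALL CREDIT: val-idea-28 (card
`king-procesi-necklace`, lens «degeneration / orbit-closure»), g0–g3.  Port hand val-port-3 g3 (desk val-lit g14 RULING #350 (A); α LEAD
val-port-2 g3 naming 21:36:52Z), `--supports stmt-ValiantsHypothesis-24318` helper.  The author's module docstring follows unchanged.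
-/

/-!
# King–Procesi necklace helper for crux `GrenetZeon.DualUnipotentThreeHalves` (residue R2 `HeavyTopLaw`)

Crux idea card `king-procesi-necklace` (val-idea-28, lens «degeneration / orbit-closure»), price P1 of the critic of
record (val-idea-crit-7, verdict #2): ONE lint-clean helper, Negative-lane / refuter-instrument grade.

**What is proved here (no `sorry`, no new axioms).**  Word currency of the tree (`word`, `WordTame`, `FlagCheap`,
✓ `flagCheap_iff_wordTame`), plus the tree's Jacobson machinery (`RadicalCoarsening.mem_jacobson_of_traceOrth`,
`exists_jacobson_pow_eq_bot`, `list_prod_mem_pow`):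

* §1 word algebra: `word_append`, `word_flatten_replicate` (= powers of a necklace), letter counts of a power.
* §2 the HEIGHT-FREE RATIO OBSTRUCTION: if `(T₀,T₁)` has ANY word profile `c·#T₁(w) ≤ Θ + r·#T₀(w)` on its nonzero
  words, then every NON-NILPOTENT word — in particular every word with NONZERO TRACE (a necklace invariant) — satisfies
  the height-free inequality `c·#T₁(w) ≤ r·#T₀(w)` (`ratio_le_of_profile_of_trace_ne_zero`): powers of the word stay
  nonzero, and the affine term `Θ` is killed by amplification `w ↦ w^j`.
* §3 the refuter's kill in necklace form: ONE word `w` with `tr(word T₀ T₁ w) ≠ 0` and `T₁`-fraction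
  `#T₁(w)/|w| ≥ (k+1)/(n−1)` forbids `WordTame n k T₀ T₁` — for words of ANY length (`not_wordTame_of_trace_word_ne_zero`;
  compare the tree's `not_wordTame_of_word`, which needs `|w| ≤ n − 1` but only `word ≠ 0`), and its pencil form
  `not_flagCheap_of_trace_words` (via ✓ `flagCheap_iff_wordTame`).
* §4 the grading side (gen-0 sketch, now lint-clean): `LevelAdapted` bases make every ratio-rich word traceless
  (`trace_word_eq_zero_of_levelAdapted`), in any conjugate basis (`trace_word_conj`,
  `not_levelAdapted_conj_of_trace_word_ne_zero`).
* §5 RATIO COMPLETENESS (King's criterion made elementary, Jacobson form): if every `(r:c)`-rich necklace is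
  TRACELESS then a word profile of ratio `(r:c)` EXISTS — `∃ Θ, ∀ w, word ≠ 0 → c·#T₁(w) ≤ Θ + r·#T₀(w)`
  (`exists_profile_of_necklace_null`, `Θ = c·(L−1)`, `L` the nilpotency exponent of the radical of the positive-degree
  algebra `Algebra.adjoin ℂ (richWords …)`; hence `WordTame n k` for every `k ≥ (Θ + r(n−1))/(c+r)`,
  `exists_wordTame_of_necklace_null`).  Mechanism: rich ⊗ rich = rich, so the rich words are trace-orthogonal to the
  algebra they generate, hence radical, hence products of `L` of them vanish; a word of necklace degree `> c(L−1)` cuts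
  greedily into `L` rich pieces (`exists_rich_pieces`).

**Reading (the RATIO / HEIGHT split of the card, P2) — now a theorem pair.**  §2 + §5: the necklace traces
`tr w(T₀,T₁)` decide EXACTLY the RATIO clause of a flag certificate (which `(r:c)` admit a profile at all) and are
BLIND to its HEIGHT clause (the word-currency `Θ`, flag-currency level count `p ≲ budget`): nullity gives a profile with
SOME height (`≤ c·(L−1)`, `L ≤ m` by Nakayama on the chain `J^i V` — not formalised), a nonzero rich trace forbids EVERY height.
Calibration of record ((4,7)-fold, crit-7 16:35Z): `NSeven` is necklace-null at every ratio (triangular pencil) yet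
not flag-cheap (✗ p648631) — the law R2 lives in the height clause; the necklace instrument can only ever detect
RATIO-expensive objects (irreducible blocks with a fat non-nilpotent word), which is what S1b's fat blocks must be
tested for.

Nothing here proves R2, the crux, or VP ≠ VNP; 24318 is OPEN.
-/

-- single-conjunct layout: Sub = Summit, duplicated namespace component intended
set_option linter.dupNamespace false

namespace Summit.ValiantsHypothesis.ValiantsHypothesis.Theorems.GrenetZeon.Necklace

open Summit.ValiantsHypothesis.ValiantsHypothesis.Theorems.GrenetZeon.RadicalSplit
open Summit.ValiantsHypothesis.ValiantsHypothesis.Cruxes.TwoDimCoefficients.DimTwoCases (AffMat IsAffine)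

variable {m : ℕ}

/-! ## §1 Word algebra: concatenation, powers of a necklace, letter counts -/

/-- Words multiply under concatenation. [folklore] -/
theorem word_append (T₀ T₁ : Matrix (Fin m) (Fin m) ℂ) (w w' : List Bool) :
    word T₀ T₁ (w ++ w') = word T₀ T₁ w * word T₀ T₁ w' := by
  simp [word, List.map_append, List.prod_append]

/-- The `j`-th power of a necklace is the word of the `j`-fold repetition. [folklore] -/
theorem word_flatten_replicate (T₀ T₁ : Matrix (Fin m) (Fin m) ℂ) (w : List Bool) (j : ℕ) :
    word T₀ T₁ (List.replicate j w).flatten = word T₀ T₁ w ^ j := by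
  induction j with
  | zero => simp [word]
  | succ j ih => rw [List.replicate_succ, List.flatten_cons, word_append, ih, pow_succ']

/-- Letter counts of a repetition. [folklore] -/
theorem count_flatten_replicate (w : List Bool) (j : ℕ) (b : Bool) :
    ((List.replicate j w).flatten).count b = j * w.count b := by
  induction j with
  | zero => simp
  | succ j ih => rw [List.replicate_succ, List.flatten_cons, List.count_append, ih]; ring

/-- `|w| = #T₀(w) + #T₁(w)` for Boolean words. [folklore] -/
theorem length_eq_count_false_add_count_true (w : List Bool) :
    w.length = w.count false + w.count true := by
  have h := List.count_not_add_count w true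
  rw [Bool.not_true] at h
  exact h.symm

/-! ## §2 The height-free ratio obstruction (amplification `w ↦ w^j`) -/

/-- **Ratio bound for non-nilpotent words.**  Under a word profile `c·#T₁ ≤ Θ + r·#T₀` on nonzero words, a word all of
whose powers are nonzero satisfies the HEIGHT-FREE bound `c·#T₁(w) ≤ r·#T₀(w)`: apply the profile to `w^{Θ+1}`.
[this file] -/
theorem ratio_le_of_profile_of_forall_pow_ne_zero (T₀ T₁ : Matrix (Fin m) (Fin m) ℂ) {r c Θ : ℕ}
    (hW : ∀ w : List Bool, word T₀ T₁ w ≠ 0 → c * w.count true ≤ Θ + r * w.count false)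
    (w : List Bool) (hpow : ∀ j : ℕ, word T₀ T₁ w ^ j ≠ 0) :
    c * w.count true ≤ r * w.count false := by
  refine le_of_not_gt fun hlt => ?_
  have h := hW (List.replicate (Θ + 1) w).flatten (by rw [word_flatten_replicate]; exact hpow (Θ + 1))
  rw [count_flatten_replicate, count_flatten_replicate] at h
  have h1 : (Θ + 1) * (r * w.count false + 1) ≤ (Θ + 1) * (c * w.count true) :=
    Nat.mul_le_mul_left (Θ + 1) (Nat.succ_le_of_lt hlt)
  nlinarith [h, h1]

/-- A matrix with nonzero trace is not nilpotent (`ℂ` is reduced). [folklore] -/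
theorem not_isNilpotent_of_trace_ne_zero {M : Matrix (Fin m) (Fin m) ℂ} (h : Matrix.trace M ≠ 0) :
    ¬ IsNilpotent M :=
  fun hM => h (Matrix.isNilpotent_trace_of_isNilpotent hM).eq_zero

/-- All powers of a matrix with nonzero trace are nonzero. [folklore] -/
theorem pow_ne_zero_of_trace_ne_zero {M : Matrix (Fin m) (Fin m) ℂ} (h : Matrix.trace M ≠ 0) (j : ℕ) :
    M ^ j ≠ 0 :=
  fun hj => not_isNilpotent_of_trace_ne_zero h ⟨j, hj⟩

/-- **Necklace form of the ratio obstruction.**  Under a word profile `c·#T₁ ≤ Θ + r·#T₀` on nonzero words, every word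
with NONZERO TRACE satisfies `c·#T₁(w) ≤ r·#T₀(w)` — independently of the height `Θ`. [this file] -/
theorem ratio_le_of_profile_of_trace_ne_zero (T₀ T₁ : Matrix (Fin m) (Fin m) ℂ) {r c Θ : ℕ}
    (hW : ∀ w : List Bool, word T₀ T₁ w ≠ 0 → c * w.count true ≤ Θ + r * w.count false)
    (w : List Bool) (htr : Matrix.trace (word T₀ T₁ w) ≠ 0) :
    c * w.count true ≤ r * w.count false :=
  ratio_le_of_profile_of_forall_pow_ne_zero T₀ T₁ hW w (pow_ne_zero_of_trace_ne_zero htr)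

/-! ## §3 The refuter's kill in necklace currency, and its pencil form -/

/-- **One fat necklace kills word-tameness.**  If some word `w` has `tr(word T₀ T₁ w) ≠ 0`, contains a letter `T₁`, and
has `T₁`-fraction at least `(k+1)/(n−1)` — `(k+1)·|w| ≤ (n−1)·#T₁(w)` — then `¬ WordTame n k T₀ T₁`.  No bound on
`|w|` is needed (contrast ✓ `not_wordTame_of_word`). [this file] -/
theorem not_wordTame_of_trace_word_ne_zero {n k : ℕ} (T₀ T₁ : Matrix (Fin m) (Fin m) ℂ) (w : List Bool)
    (htr : Matrix.trace (word T₀ T₁ w) ≠ 0) (ht : 0 < w.count true)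
    (hk : (k + 1) * w.length ≤ (n - 1) * w.count true) : ¬ WordTame n k T₀ T₁ := by
  rintro ⟨r, c, Θ, hc, hbud, hW⟩
  have hrat := ratio_le_of_profile_of_trace_ne_zero T₀ T₁ hW w htr
  rw [length_eq_count_false_add_count_true] at hk
  have hcr : 0 < c + r := by omega
  have hlt : Θ + r * (n - 1) < (k + 1) * (c + r) :=
    (Nat.div_lt_iff_lt_mul hcr).1 (Nat.lt_succ_of_le hbud)
  have h1 : (k + 1) * (c * w.count true) ≤ (k + 1) * (r * w.count false) := Nat.mul_le_mul_left _ hrat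
  have h2 : r * ((k + 1) * (w.count false + w.count true)) ≤ r * ((n - 1) * w.count true) :=
    Nat.mul_le_mul_left _ hk
  have h3 : (k + 1) * (c + r) * w.count true ≤ r * (n - 1) * w.count true := by nlinarith [h1, h2]
  have h4 : (k + 1) * (c + r) ≤ r * (n - 1) := Nat.le_of_mul_le_mul_right h3 ht
  omega

/-- **Pencil form (ENEMY CRITERION, necklace version).**  If inside EVERY direction space `K` with `(k+1)·n < dim K`
some line `x + s·v`, `v ∈ K`, carries a necklace `w` in `{N(x), N_lin(v)}` with NONZERO TRACE and `N_lin`-fraction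
`≥ (k+1)/(n−1)`, then the affine pencil `N` is not flag-cheap. [this file; ✓ `flagCheap_iff_wordTame`] -/
theorem not_flagCheap_of_trace_words {n : ℕ} (N : AffMat n m) (hN : IsAffine N)
    (h : ∀ (K : Submodule ℂ (Fin n × Fin n → ℂ)) (k : ℕ), (k + 1) * n < Module.finrank ℂ K →
      ∃ x v : Fin n × Fin n → ℂ, v ∈ K ∧ ∃ w : List Bool,
        Matrix.trace (word (N.map (MvPolynomial.eval x)) (linPart N v) w) ≠ 0 ∧ 0 < w.count true ∧
          (k + 1) * w.length ≤ (n - 1) * w.count true) :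
    ¬ FlagCheap n m N := by
  rw [flagCheap_iff_wordTame N hN]
  rintro ⟨K, k, hdim, hW⟩
  obtain ⟨x, v, hv, w, hw, ht, hl⟩ := h K k hdim
  exact not_wordTame_of_trace_word_ne_zero _ _ w hw ht hl (hW x v hv)

/-! ## §4 The grading side: level-adapted bases make ratio-rich necklaces traceless -/

/-- `(P, Q)` is LEVEL-ADAPTED with drop `r` and climb `c` in the standard basis: `P` lowers the level by at most `r`,
`Q` raises it by at least `c` (the `e = 0 / e = 1` clauses of `FlagAdapted` with `c = a + 1 − r`). -/
def LevelAdapted (lvl : Fin m → ℕ) (r c : ℕ) (P Q : Matrix (Fin m) (Fin m) ℂ) : Prop :=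
  (∀ i j, P i j ≠ 0 → lvl j ≤ lvl i + r) ∧ (∀ i j, Q i j ≠ 0 → lvl j + c ≤ lvl i)

/-- Weight bookkeeping along a word: every nonzero entry `(word P Q w) i j` satisfies
`lvl j + c·#Q(w) ≤ lvl i + r·#P(w)`. [folklore] -/
theorem levels_of_word_ne_zero (lvl : Fin m → ℕ) (r c : ℕ) (P Q : Matrix (Fin m) (Fin m) ℂ)
    (h : LevelAdapted lvl r c P Q) :
    ∀ (w : List Bool) (i j : Fin m), word P Q w i j ≠ 0 →
      lvl j + c * w.count true ≤ lvl i + r * w.count false := by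
  intro w
  induction w with
  | nil =>
    intro i j hij
    by_cases h' : i = j
    · subst h'; simp
    · exfalso; apply hij; simp [word, h']
  | cons b w ih =>
    intro i j hij
    rw [word_cons, Matrix.mul_apply] at hij
    obtain ⟨l, -, hl⟩ := Finset.exists_ne_zero_of_sum_ne_zero hij
    have h1 : (if b then Q else P) i l ≠ 0 := left_ne_zero_of_mul hl
    have h2 : word P Q w l j ≠ 0 := right_ne_zero_of_mul hl
    have ih' := ih l j h2
    cases b with
    | true =>
      rw [if_pos rfl] at h1
      have hQ := h.2 i l h1
      rw [List.count_cons_self, List.count_cons_of_ne (by decide)]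
      nlinarith [hQ, ih']
    | false =>
      rw [if_neg (by decide)] at h1
      have hP := h.1 i l h1
      rw [List.count_cons_self, List.count_cons_of_ne (by decide)]
      nlinarith [hP, ih']

/-- **Easy direction of the King–Procesi criterion.**  If `(P,Q)` is level-adapted with drop `r` / climb `c`, every
RATIO-RICH word (`r·#P < c·#Q`) is traceless (indeed has zero diagonal). [this file] -/
theorem trace_word_eq_zero_of_levelAdapted (lvl : Fin m → ℕ) (r c : ℕ) (P Q : Matrix (Fin m) (Fin m) ℂ)
    (h : LevelAdapted lvl r c P Q) (w : List Bool) (hw : r * w.count false < c * w.count true) :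
    Matrix.trace (word P Q w) = 0 := by
  unfold Matrix.trace
  apply Finset.sum_eq_zero
  intro i _
  by_contra hi
  have := levels_of_word_ne_zero lvl r c P Q h w i i (by simpa [Matrix.diag] using hi)
  omega

/-- Words are conjugation-equivariant. [folklore] -/
theorem word_conj (g : (Matrix (Fin m) (Fin m) ℂ)ˣ) (P Q : Matrix (Fin m) (Fin m) ℂ) (w : List Bool) :
    word ((g : Matrix (Fin m) (Fin m) ℂ) * P * ((g⁻¹ : (Matrix (Fin m) (Fin m) ℂ)ˣ) : Matrix (Fin m) (Fin m) ℂ))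
         ((g : Matrix (Fin m) (Fin m) ℂ) * Q * ((g⁻¹ : (Matrix (Fin m) (Fin m) ℂ)ˣ) : Matrix (Fin m) (Fin m) ℂ)) w =
      (g : Matrix (Fin m) (Fin m) ℂ) * word P Q w * ((g⁻¹ : (Matrix (Fin m) (Fin m) ℂ)ˣ) : Matrix (Fin m) (Fin m) ℂ) := by
  induction w with
  | nil => simp [word]
  | cons b w ih =>
    rw [word_cons, word_cons, ih]
    cases b <;> simp [Matrix.mul_assoc]

/-- Necklace traces are conjugation invariants. [folklore] -/
theorem trace_word_conj (g : (Matrix (Fin m) (Fin m) ℂ)ˣ) (P Q : Matrix (Fin m) (Fin m) ℂ) (w : List Bool) :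
    Matrix.trace (word ((g : Matrix (Fin m) (Fin m) ℂ) * P * ((g⁻¹ : (Matrix (Fin m) (Fin m) ℂ)ˣ) : Matrix (Fin m) (Fin m) ℂ))
         ((g : Matrix (Fin m) (Fin m) ℂ) * Q * ((g⁻¹ : (Matrix (Fin m) (Fin m) ℂ)ˣ) : Matrix (Fin m) (Fin m) ℂ)) w) =
      Matrix.trace (word P Q w) := by
  rw [word_conj, Matrix.trace_mul_cycle, Units.inv_mul, Matrix.one_mul]

/-- **The grading obstruction, basis-free.**  If in SOME basis `(P,Q)` is level-adapted with drop `r` / climb `c`,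
every ratio-rich necklace is traceless; contrapositively ONE ratio-rich necklace with nonzero trace forbids every
`(r:c)`-adapted grading in every basis. [this file] -/
theorem not_levelAdapted_conj_of_trace_word_ne_zero (g : (Matrix (Fin m) (Fin m) ℂ)ˣ) (lvl : Fin m → ℕ) (r c : ℕ)
    (P Q : Matrix (Fin m) (Fin m) ℂ) (w : List Bool) (hw : r * w.count false < c * w.count true)
    (htr : Matrix.trace (word P Q w) ≠ 0) :
    ¬ LevelAdapted lvl r c
        ((g : Matrix (Fin m) (Fin m) ℂ) * P * ((g⁻¹ : (Matrix (Fin m) (Fin m) ℂ)ˣ) : Matrix (Fin m) (Fin m) ℂ))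
        ((g : Matrix (Fin m) (Fin m) ℂ) * Q * ((g⁻¹ : (Matrix (Fin m) (Fin m) ℂ)ˣ) : Matrix (Fin m) (Fin m) ℂ)) := by
  intro h
  apply htr
  rw [← trace_word_conj g]
  exact trace_word_eq_zero_of_levelAdapted lvl r c _ _ h w hw

end Summit.ValiantsHypothesis.ValiantsHypothesis.Theorems.GrenetZeon.Necklace
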